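import Mathlib.Analysis.Complex.Liouville
import Mathlib.Analysis.Complex.RealDeriv
import Summits.QuantumFields.BalabanUV.T4Continuum.Spine.NE4.FadingFromRateUnder

/-!
# Spine/NE4/FadingFromRateAnalytic — the ANALYTIC exchange rate at node U2: complex NE4 + analyticity in each coupling give the
# history moduli AND their fading at the SAME rate `θ` (Cauchy's estimate), not `√θ`

Cell `pub-balaban-gaps` (YM blitz G2), seat `ne4`, generation 5 (unit `pub-balaban-gaps-ne4-g5`); record `HOME/ne/NE4.md` §5 (R34).  Sequel of
`Spine/NE4/FadingFromRate` (g3, (R29): NE4 + a C^{1,1} bound per coupling ⇒ `HistLipschitz ∧ FadingMemory` at rate `√θ`, EXACT under C^{1,1} by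
`Spine/NE4/FadingFromRateSharp`; its header names the analytic alternative without formalising it).

THE POINT.  Replace the real-variable Landau–Kolmogorov step by CAUCHY'S ESTIMATE.  Suppose the β-functions extend to complex couplings —
`βc : HBetaC`, `βc = β` on real histories (`ExtendsC`) — with (i) NE4 on the closed complex `r`-neighbourhood of the boxes (`ScaleShiftRateC c θ γ r βc`:
`‖βc_{k+2}(w) − βc_{k+1}(Fin.tail w)‖ ≤ c·θ^k` whenever every entry of `w` is within `r` of `]0,γ]`) and (ii) every one-coupling section
`z ↦ βc_{k+1}(…, g_i = z, …)` through a real box history holomorphic near that neighbourhood and bounded by `B` on it (`CoordAnalyticC B γ r βc`).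
Then the (E33a) telescoping runs verbatim over ℂ (§2), the OSCILLATION of the section in an age-`a` coupling is `≤ E₀·θ^a` on the whole complex
neighbourhood, `E₀ = max(2B, 2c∕(θ(1−θ)))` (§3), Cauchy's estimate on the circle of radius `r` about each real coupling gives `|∂β_{k+1}∕∂g_i| ≤
E₀θ^a∕r` on `]0,γ]`, and the mean value inequality along the real interval gives the moduli `Λ₁ k i = (E₀∕r)·θ^{k−i}` (§4):
`HistLipschitz Λ₁ γ β ∧ FadingMemory (E₀∕r) θ Λ₁` — rate `θ` ITSELF, no loss (`histLipschitz_fadingMemory_of_analytic`).  The real NE4 and the real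
uniform bound are RECOVERED from (i)–(ii) (`scaleShiftRate_of_extendsC`, `bound_of_coordAnalyticC`), so node U2's input triple (`Spine.NE4.U2Inputs`)
and its geometric K-uniform output `U2Output D g₀ (2c∕(1−θ)) θ` follow from {complex NE4, coordinatewise analyticity with a bound} at NE4's own
rate (§5).  ONE RADIUS: `E₀∕r` does not involve the size of the coupling box, so — unlike (R29)'s `C₁ ≥ 4B∕γᵤ` — the window
`(E₀∕r)·((k₀+1)γ³ + 2γ∕b) ≤ (1−θ)∕2` holds on ONE box `]0,γ]` once `γ ≲ r·b(1−θ)∕(16B)`, i.e. exactly when the analyticity radius `r` does NOT shrink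
with the run box (sections analytic on a disc about `g = 0` of radius `≫ γ` — the literal reading of p. 264's *"defined on the interval [0, γ], (or
analytic)"*); with `r ≲ γ` the two-radii bookkeeping of (R29) returns (`γ ≤ γᵤ` is kept in every theorem below).

WHAT IS NOT CLAIMED.  From the REAL NE4 alone plus (ii) one gets only `θ^{age}·O(age)` (two-constants theorem, harmonic measure — not formalised);
(i) asks NE4's inequality for complex couplings, the shape a derivation of NE4 by Cauchy-type estimates in the couplings would deliver.  Whether
Bałaban's `E^{(j)}`, `β_{j+1}` admit complex couplings at all (the densities `exp(−A∕g²)` are built for real `g > 0`) is NOT asserted: (i) and (ii)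
are HYPOTHESIS SHAPES, UNPRINTED like NE4 itself (GAPS G-t4-U2-1∕-2); only the TYPE of (ii) for the LAST coupling is printed ([Balaban1987RG1] p. 264
*"smooth … (or analytic), uniformly bounded on this interval together with all derivatives"*, uniformity in `j` unprinted, G-adv2-3).  This
analyticity is in the COUPLINGS — not the background-field analyticity of the read-out recipe `T4BetaReadOutLipschitz` ((1.17)∕(4.4), `cr = 8K∕α²`).

HONEST FRAMING: bookkeeping + elementary complex analysis (Mathlib's Cauchy estimate `Complex.norm_deriv_le_of_forall_mem_sphere_norm_le`) over
HYPOTHESIS SHAPES on an ABSTRACT family; nothing of Bałaban's asserted beyond print; NE4 NOT IN PRINT, NOT PROVED; spine PROVED 0∕9 unchanged;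
NOT the continuum limit on ℝ⁴, NOT infinite volume, NOT a mass gap, NOT Clay.  HONEST DEPENDENCY: continuum YM on T⁴ ⇐ BetaPertH ∧ nine spine
estimates (0∕9 proved); BetaPertH ⇐ (D1) ∧ (D4) ∧ CAP+tail.  Reference (TYPES only): [Balaban1987RG1] = T. Bałaban, Commun. Math. Phys. **109**
(1987) 249–301, (0.20) p. 256, p. 264, p. 298.
-/

noncomputable section

namespace Summit.QuantumFields.BalabanUV.T4Continuum.Spine.NE4

open Set Metric
open Literature.MathematicalPhysics.QuantumFieldTheory.Balaban1983to89
open Literature.MathematicalPhysics.QuantumFieldTheory.Balaban1983to89.FlowStep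
open Literature.MathematicalPhysics.QuantumFieldTheory.Balaban1983to89.T4CouplingMatching
open Literature.MathematicalPhysics.QuantumFieldTheory.Balaban1983to89.T4Continuum

universe u

/-! ## §1 Complex histories: the `r`-neighbourhood of the coupling interval, complex boxes, the three shapes -/

/-- Complex history families: `βc k (w_0, …, w_k)` = the complex extension of `β_{k+1}(g_0, …, g_k)`. [folklore] -/
abbrev HBetaC : Type := (k : ℕ) → (Fin (k + 1) → ℂ) → ℂ

/-- The closed complex `r`-neighbourhood of the coupling interval `]0,γ]`: points within `r` of some `t ∈ ]0,γ]`. [folklore] -/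
def Nbhd (r γ : ℝ) : Set ℂ := {z | ∃ t ∈ Ioc (0 : ℝ) γ, ‖z - (t : ℂ)‖ ≤ r}

/-- A real coupling `t ∈ ]0,γ]` lies in the neighbourhood (`r ≥ 0`). [folklore] -/
theorem ofReal_mem_nbhd {r γ t : ℝ} (hr : 0 ≤ r) (ht : t ∈ Ioc (0 : ℝ) γ) : (t : ℂ) ∈ Nbhd r γ :=
  ⟨t, ht, by simpa using hr⟩

/-- The closed disc of radius `r` about a real coupling `t ∈ ]0,γ]` lies in the neighbourhood. [folklore] -/
theorem mem_nbhd_of_mem_closedBall {r γ t : ℝ} {z : ℂ} (ht : t ∈ Ioc (0 : ℝ) γ) (hz : z ∈ closedBall (t : ℂ) r) :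
    z ∈ Nbhd r γ :=
  ⟨t, ht, by rwa [mem_closedBall, dist_eq_norm] at hz⟩

/-- The neighbourhoods grow with the box. [folklore] -/
theorem nbhd_mono {r γ γ' : ℝ} (h : γ ≤ γ') : Nbhd r γ ⊆ Nbhd r γ' :=
  fun _ ⟨t, ht, hz⟩ => ⟨t, ⟨ht.1, ht.2.trans h⟩, hz⟩

/-- COMPLEX BOXES: histories `(w_0, …, w_k)` each of whose entries lies in the `r`-neighbourhood of `]0,γ]`. [folklore] -/
def CBox (r γ : ℝ) (k : ℕ) : Set (Fin (k + 1) → ℂ) := {w | ∀ i, w i ∈ Nbhd r γ}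

/-- A real box history, complexified, lies in the complex box (`r ≥ 0`). [folklore] -/
theorem ofReal_mem_cbox {r γ : ℝ} {k : ℕ} {p : Fin (k + 1) → ℝ} (hr : 0 ≤ r) (hp : p ∈ Box γ k) :
    (fun j => (p j : ℂ)) ∈ CBox r γ k :=
  fun j => ofReal_mem_nbhd hr ((mem_box.mp hp) j)

/-- Replacing one entry by a point of the neighbourhood stays in the complex box. [folklore] -/
theorem update_mem_cbox {r γ : ℝ} {k : ℕ} {w : Fin (k + 1) → ℂ} (hw : w ∈ CBox r γ k) (i : Fin (k + 1)) {z : ℂ}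
    (hz : z ∈ Nbhd r γ) : Function.update w i z ∈ CBox r γ k := by
  intro j
  by_cases hj : j = i
  · subst hj; simpa using hz
  · simp only [CBox, Set.mem_setOf_eq] at hw
    rw [Function.update_of_ne hj]; exact hw j

/-- The complex boxes grow with the box. [folklore] -/
theorem cbox_mono {r γ γ' : ℝ} (h : γ ≤ γ') (k : ℕ) : CBox r γ k ⊆ CBox r γ' k :=
  fun _ hw j => nbhd_mono h (hw j)

/-- [shape] HYPOTHESIS SHAPE — **A COMPLEX EXTENSION** of the real history family: `βc` agrees with `β` on real histories.  (Real-analyticity of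
`β_{j+1}` in its couplings is the printed TYPE for the LAST coupling, [Balaban1987RG1] p. 264 *"(or analytic)"*; for the preceding ones print
says only that the dependence exists, p. 298.)  A parametric definition of a proposition — NOT a fact. [folklore] -/
def ExtendsC (β : HBeta) (βc : HBetaC) : Prop :=
  ∀ k (v : Fin (k + 1) → ℝ), βc k (fun j => (v j : ℂ)) = (β k v : ℂ)

/-- [shape] HYPOTHESIS SHAPE — **COMPLEX NE4**: the scale-shift inequality of `T4CouplingMatching.ScaleShiftRate` for the complex extension, on
the complex boxes — `‖βc_{k+2}(w_0,…,w_{k+1}) − βc_{k+1}(w_1,…,w_{k+1})‖ ≤ c·θ^k` whenever every `w_i` is within `r` of `]0,γ]`.  UNPRINTED like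
NE4 (GAPS G-t4-U2-1); the shape a Cauchy-type derivation of NE4 in the couplings would deliver.  NOT a fact. [folklore] -/
def ScaleShiftRateC (c θ γ r : ℝ) (βc : HBetaC) : Prop :=
  ∀ k (w : Fin (k + 2) → ℂ), w ∈ CBox r γ (k + 1) → ‖βc (k + 1) w - βc k (Fin.tail w)‖ ≤ c * θ ^ k

/-- [shape] HYPOTHESIS SHAPE — **COORDINATEWISE ANALYTICITY WITH A UNIFORM BOUND**: for every scale `k`, every REAL box history `p ∈ ]0,γ]^{k+1}`
and every coordinate `i ≤ k`, the one-coupling section `z ↦ βc_{k+1}(…, g_i = z, …)` is holomorphic on an open set containing the closed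
`r`-neighbourhood `Nbhd r γ` of `]0,γ]` and bounded by `B` on that neighbourhood — ONE `r`, ONE `B` for all `k`, `i`, `p`.  Printed TYPE for
`i = k` ([Balaban1987RG1] p. 264 *"(or analytic), uniformly bounded"*; uniformity in `k` unprinted, GAPS G-adv2-3), UNPRINTED for `i < k`
(G-t4-U2-2); a regularity-and-size statement, NO decay content.  NOT a fact. [folklore] -/
def CoordAnalyticC (B γ r : ℝ) (βc : HBetaC) : Prop :=
  ∀ k (p : Fin (k + 1) → ℝ), p ∈ Box γ k → ∀ i : Fin (k + 1), ∃ U : Set ℂ, IsOpen U ∧ Nbhd r γ ⊆ U ∧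
    DifferentiableOn ℂ (fun z : ℂ => βc k (Function.update (fun j => (p j : ℂ)) i z)) U ∧
    ∀ z ∈ Nbhd r γ, ‖βc k (Function.update (fun j => (p j : ℂ)) i z)‖ ≤ B

/-- [bookkeeping] **THE REAL NE4 IS RECOVERED**: `ExtendsC β βc` and `ScaleShiftRateC c θ γ r βc` (`r ≥ 0`) give `ScaleShiftRate c θ γ β`
(real box histories are complex box histories). [folklore] -/
theorem scaleShiftRate_of_extendsC {β : HBeta} {βc : HBetaC} {c θ γ r : ℝ} (hE : ExtendsC β βc)
    (hS : ScaleShiftRateC c θ γ r βc) (hr : 0 ≤ r) : ScaleShiftRate c θ γ β := by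
  intro k w hw
  have h := hS k (fun j => (w j : ℂ)) (ofReal_mem_cbox hr hw)
  have htail : Fin.tail (fun j : Fin (k + 2) => (w j : ℂ)) = fun j => ((Fin.tail w) j : ℂ) := rfl
  rw [htail, hE (k + 1) w, hE k (Fin.tail w), ← Complex.ofReal_sub, Complex.norm_real, Real.norm_eq_abs] at h
  exact h

/-- [bookkeeping] **THE REAL UNIFORM BOUND IS RECOVERED**: `ExtendsC β βc` and `CoordAnalyticC B γ r βc` (`r ≥ 0`) give `|β_{k+1}| ≤ B` on the
boxes `]0,γ]^{k+1}` (the section through `p` in coordinate `0` at the real point `p_0`). [folklore] -/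
theorem bound_of_coordAnalyticC {β : HBeta} {βc : HBetaC} {B γ r : ℝ} (hE : ExtendsC β βc) (hA : CoordAnalyticC B γ r βc)
    (hr : 0 ≤ r) : ∀ k (v : Fin (k + 1) → ℝ), v ∈ Box γ k → |β k v| ≤ B := by
  intro k v hv
  obtain ⟨U, -, -, -, hbnd⟩ := hA k v hv 0
  have h := hbnd (v 0 : ℂ) (ofReal_mem_nbhd hr ((mem_box.mp hv) 0))
  have hupd : Function.update (fun j => (v j : ℂ)) 0 (v 0 : ℂ) = fun j => (v j : ℂ) := Function.update_eq_self _ _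
  rw [hupd, hE k v, Complex.norm_real, Real.norm_eq_abs] at h
  exact h

/-! ## §2 The (E33a) telescoping over ℂ: deleting the oldest couplings moves `βc` by a geometric tail -/

/-- Complex prefixes of a coupling sequence: `cpre g k = (g_0, …, g_k)`. [folklore] -/
def cpre (g : ℕ → ℂ) (k : ℕ) : Fin (k + 1) → ℂ := fun i => g i

/-- Dropping the oldest entry of a prefix = the prefix of the shifted sequence (`T4CouplingMatching.tail_prefixOf` over ℂ). [folklore] -/
theorem tail_cpre (g : ℕ → ℂ) (k : ℕ) : Fin.tail (cpre g (k + 1)) = cpre (fun n => g (n + 1)) k := rfl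

/-- Prefixes of a sequence staying in the neighbourhood up to index `N` lie in the complex boxes. [folklore] -/
theorem cpre_mem_cbox {r γ : ℝ} {g : ℕ → ℂ} {N k : ℕ} (hk : k ≤ N) (hg : ∀ m, m ≤ N → g m ∈ Nbhd r γ) :
    cpre g k ∈ CBox r γ k :=
  fun i => hg i (by have := i.is_lt; omega)

/-- **FADING OSCILLATION FROM COMPLEX NE4** ((E33a) `abs_sub_shift_le` over ℂ): under `ScaleShiftRateC c θ γ r βc`, for a complex sequence `g`
with `g_m ∈ Nbhd r γ` for `m ≤ l + s`, `‖βc (l+s) (g_0,…,g_{l+s}) − βc l (g_s,…,g_{l+s})‖ ≤ Σ_{n ∈ [l,l+s)} c·θ^n` (induction on the number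
`s` of deleted oldest couplings). [folklore] -/
theorem norm_sub_shift_le_C {βc : HBetaC} {c θ γ r : ℝ} (hS : ScaleShiftRateC c θ γ r βc) :
    ∀ (s l : ℕ) (g : ℕ → ℂ), (∀ m, m ≤ l + s → g m ∈ Nbhd r γ) →
      ‖βc (l + s) (cpre g (l + s)) - βc l (cpre (fun n => g (n + s)) l)‖ ≤ ∑ n ∈ Finset.Ico l (l + s), c * θ ^ n := by
  intro s
  induction s with
  | zero => intro l g _; simp
  | succ s ih =>
    intro l g hg
    have hbox : cpre g (l + s + 1) ∈ CBox r γ (l + s + 1) := cpre_mem_cbox le_rfl (by simpa [Nat.add_assoc] using hg)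
    have h1 : ‖βc (l + s + 1) (cpre g (l + s + 1)) - βc (l + s) (cpre (fun n => g (n + 1)) (l + s))‖ ≤ c * θ ^ (l + s) := by
      have h := hS (l + s) (cpre g (l + s + 1)) hbox
      rwa [tail_cpre] at h
    have h2 := ih l (fun n => g (n + 1)) (fun m hm => hg (m + 1) (by omega))
    have e : (fun n => (fun m => g (m + 1)) (n + s)) = fun n => g (n + (s + 1)) := by
      funext n; simp only [Nat.add_assoc, Nat.add_comm s 1]
    rw [e] at h2
    rw [show l + (s + 1) = l + s + 1 by omega, Finset.sum_Ico_succ_top (by omega : l ≤ l + s)]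
    calc ‖βc (l + s + 1) (cpre g (l + s + 1)) - βc l (cpre (fun n => g (n + (s + 1))) l)‖
        ≤ ‖βc (l + s + 1) (cpre g (l + s + 1)) - βc (l + s) (cpre (fun n => g (n + 1)) (l + s))‖
          + ‖βc (l + s) (cpre (fun n => g (n + 1)) (l + s)) - βc l (cpre (fun n => g (n + (s + 1))) l)‖ :=
          norm_sub_le_norm_sub_add_norm_sub _ _ _
      _ ≤ c * θ ^ (l + s) + ∑ n ∈ Finset.Ico l (l + s), c * θ ^ n := add_le_add h1 h2
      _ = ∑ n ∈ Finset.Ico l (l + s), c * θ ^ n + c * θ ^ (l + s) := by ring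

/-- **… UNIFORMLY IN THE NUMBER OF DELETED COUPLINGS**: `≤ c·θ^l∕(1−θ)` (`c ≥ 0`, `0 ≤ θ < 1`), `l` = the number of KEPT older scales.
[folklore] -/
theorem norm_sub_shift_le_geom_C {βc : HBetaC} {c θ γ r : ℝ} (hS : ScaleShiftRateC c θ γ r βc) (hc : 0 ≤ c) (hθ0 : 0 ≤ θ)
    (hθ1 : θ < 1) (s l : ℕ) (g : ℕ → ℂ) (hg : ∀ m, m ≤ l + s → g m ∈ Nbhd r γ) :
    ‖βc (l + s) (cpre g (l + s)) - βc l (cpre (fun n => g (n + s)) l)‖ ≤ c * θ ^ l / (1 - θ) := by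
  refine (norm_sub_shift_le_C hS s l g hg).trans ?_
  rw [← Finset.mul_sum]
  calc c * ∑ n ∈ Finset.Ico l (l + s), θ ^ n ≤ c * (θ ^ l / (1 - θ)) :=
        mul_le_mul_of_nonneg_left (geom_sum_Ico_le_of_lt_one hθ0 hθ1) hc
    _ = c * θ ^ l / (1 - θ) := by ring

/-! ## §3 Complex NE4 caps the oscillation of `βc_{k+1}` in an old coupling on the WHOLE complex neighbourhood -/

/-- **THE OSCILLATION CAP OVER ℂ** (`abs_sub_le_of_agree_young` verbatim over ℂ): under `ScaleShiftRateC c θ γ r βc` (`c ≥ 0`, `0 < θ < 1`), two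
complex box histories `p, q ∈ CBox r γ k` that AGREE on every coordinate younger than `n < k` satisfy `‖βc k p − βc k q‖ ≤ (2c∕(θ(1−θ)))·θ^{k−n}`.
[folklore] -/
theorem norm_sub_le_of_agree_young_C {βc : HBetaC} {c θ γ r : ℝ} (hS : ScaleShiftRateC c θ γ r βc) (hc : 0 ≤ c)
    (hθ0 : 0 < θ) (hθ1 : θ < 1) {k n : ℕ} (hnk : n < k) {p q : Fin (k + 1) → ℂ} (hp : p ∈ CBox r γ k)
    (hq : q ∈ CBox r γ k) (hagree : ∀ j : Fin (k + 1), n < (j : ℕ) → p j = q j) :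
    ‖βc k p - βc k q‖ ≤ 2 * c / (θ * (1 - θ)) * θ ^ (k - n) := by
  obtain ⟨l, rfl⟩ : ∃ l, k = l + (n + 1) := ⟨k - (n + 1), by omega⟩
  -- extend the histories to sequences (junk `1` beyond the prefix; never evaluated there)
  let ext : (Fin (l + (n + 1) + 1) → ℂ) → ℕ → ℂ := fun w m => if h : m < l + (n + 1) + 1 then w ⟨m, h⟩ else 1
  have hpfx : ∀ w : Fin (l + (n + 1) + 1) → ℂ, cpre (ext w) (l + (n + 1)) = w := fun w => by
    funext i; have hi := i.isLt; simp only [cpre, ext, hi, dif_pos]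
  have hbox : ∀ w : Fin (l + (n + 1) + 1) → ℂ, w ∈ CBox r γ (l + (n + 1)) →
      ∀ m, m ≤ l + (n + 1) → ext w m ∈ Nbhd r γ := fun w hw m hm => by
    have hm' : m < l + (n + 1) + 1 := Nat.lt_succ_of_le hm
    simp only [ext, hm', dif_pos]
    exact hw ⟨m, hm'⟩
  have hshift : cpre (fun m => ext p (m + (n + 1))) l = cpre (fun m => ext q (m + (n + 1))) l := by
    funext i
    have hi : (i : ℕ) + (n + 1) < l + (n + 1) + 1 := by have := i.isLt; omega
    simp only [cpre, ext, hi, dif_pos]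
    exact hagree ⟨(i : ℕ) + (n + 1), hi⟩ (by simp; omega)
  have h1 := norm_sub_shift_le_geom_C hS hc hθ0.le hθ1 (n + 1) l (ext p) (hbox p hp)
  have h2 := norm_sub_shift_le_geom_C hS hc hθ0.le hθ1 (n + 1) l (ext q) (hbox q hq)
  rw [hpfx] at h1
  rw [hpfx, ← hshift] at h2
  have hsum : ‖βc (l + (n + 1)) p - βc (l + (n + 1)) q‖ ≤ c * θ ^ l / (1 - θ) + c * θ ^ l / (1 - θ) := by
    rw [norm_sub_rev] at h2
    exact (norm_sub_le_norm_sub_add_norm_sub _ _ _).trans (add_le_add h1 h2)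
  have h1θ : 0 < 1 - θ := by linarith
  rw [show l + (n + 1) - n = l + 1 by omega, show 2 * c / (θ * (1 - θ)) * θ ^ (l + 1)
    = c * θ ^ l / (1 - θ) + c * θ ^ l / (1 - θ) by field_simp; ring]
  exact hsum

/-- The oscillation constant `E₀ = max(2B, 2c∕(θ(1−θ)))` (as in `fadingConst`). [folklore] -/
def oscConst (c θ B : ℝ) : ℝ := max (2 * B) (2 * c / (θ * (1 - θ)))

/-- `0 ≤ oscConst c θ B` for `c ≥ 0`, `0 < θ < 1`. [folklore] -/
theorem oscConst_nonneg {c θ B : ℝ} (hc : 0 ≤ c) (hθ0 : 0 < θ) (hθ1 : θ < 1) : 0 ≤ oscConst c θ B := by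
  have h1θ : 0 < 1 - θ := by linarith
  exact le_max_of_le_right (by positivity)

/-- **… AND THE BOUND CAPS IT IN THE LAST COUPLING**: with `‖βc k p‖, ‖βc k q‖ ≤ B` in addition, agreement on the coordinates younger than
`n ≤ k` (now `n = k` allowed) gives `‖βc k p − βc k q‖ ≤ E₀·θ^{k−n}`, `E₀ = oscConst c θ B`. [folklore] -/
theorem norm_sub_le_of_agree_young_C' {βc : HBetaC} {c θ γ r B : ℝ} (hS : ScaleShiftRateC c θ γ r βc) (hc : 0 ≤ c)
    (hθ0 : 0 < θ) (hθ1 : θ < 1) {k n : ℕ} (hnk : n ≤ k) {p q : Fin (k + 1) → ℂ} (hBp : ‖βc k p‖ ≤ B)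
    (hBq : ‖βc k q‖ ≤ B) (hp : p ∈ CBox r γ k) (hq : q ∈ CBox r γ k)
    (hagree : ∀ j : Fin (k + 1), n < (j : ℕ) → p j = q j) :
    ‖βc k p - βc k q‖ ≤ oscConst c θ B * θ ^ (k - n) := by
  rcases lt_or_eq_of_le hnk with hlt | heq
  · exact (norm_sub_le_of_agree_young_C hS hc hθ0 hθ1 hlt hp hq hagree).trans
      (mul_le_mul_of_nonneg_right (le_max_right _ _) (pow_nonneg hθ0.le _))
  · subst heq
    rw [Nat.sub_self, pow_zero, mul_one]
    calc ‖βc n p - βc n q‖ ≤ ‖βc n p‖ + ‖βc n q‖ := norm_sub_le _ _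
      _ ≤ B + B := add_le_add hBp hBq
      _ = 2 * B := by ring
      _ ≤ oscConst c θ B := le_max_left _ _

/-! ## §4 Cauchy's estimate in each coupling: fading Lipschitz moduli at rate `θ` -/

/-- The constant of the derived moduli: `E₀∕r`, `E₀ = oscConst c θ B` (Cauchy radius `r`). [folklore] -/
def analyticConst (c θ B r : ℝ) : ℝ := oscConst c θ B / r

/-- `0 ≤ analyticConst c θ B r` for `c ≥ 0`, `0 < θ < 1`, `r > 0`. [folklore] -/
theorem analyticConst_nonneg {c θ B r : ℝ} (hc : 0 ≤ c) (hθ0 : 0 < θ) (hθ1 : θ < 1) (hr : 0 < r) :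
    0 ≤ analyticConst c θ B r :=
  div_nonneg (oscConst_nonneg (B := B) hc hθ0 hθ1) hr.le

/-- **COORDINATEWISE LIPSCHITZ WITH FADING CONSTANTS, RATE `θ`.**  Under `ExtendsC β βc`, `ScaleShiftRateC c θ γ r βc` (`c ≥ 0`, `0 < θ < 1`),
`CoordAnalyticC B γ r βc` and `r > 0`: changing the ONE coupling `g_i` of a real history in `]0,γ]^{k+1}` within `]0,γ]` moves `β_{k+1}` by at
most `(E₀∕r)·θ^{k−i}·|Δg_i|` — the complex section has oscillation `≤ E₀θ^{k−i}` on the `r`-neighbourhood (§3), Cauchy's estimate on the circle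
of radius `r` about each real coupling bounds its derivative by `E₀θ^{k−i}∕r` (`Complex.norm_deriv_le_of_forall_mem_sphere_norm_le` applied to
the section minus its value at the centre), and the mean value inequality along the real interval concludes. [folklore] -/
theorem abs_sub_update_le_of_analytic {β : HBeta} {βc : HBetaC} {c θ γ r B : ℝ} (hE : ExtendsC β βc)
    (hS : ScaleShiftRateC c θ γ r βc) (hc : 0 ≤ c) (hθ0 : 0 < θ) (hθ1 : θ < 1) (hA : CoordAnalyticC B γ r βc)
    (hr : 0 < r) {k : ℕ} {p : Fin (k + 1) → ℝ} (hp : p ∈ Box γ k) (i : Fin (k + 1)) {t : ℝ} (ht : t ∈ Ioc (0 : ℝ) γ) :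
    |β k (Function.update p i t) - β k p| ≤ analyticConst c θ B r * θ ^ (k - (i : ℕ)) * |t - p i| := by
  obtain ⟨U, -, hUsub, hdiff, hbnd⟩ := hA k p hp i
  have hpC : (fun j => (p j : ℂ)) ∈ CBox r γ k := ofReal_mem_cbox hr.le hp
  -- the complex one-coupling section through `p` in coordinate `i`
  let Φ : ℂ → ℂ := fun z => βc k (Function.update (fun j => (p j : ℂ)) i z)
  -- its oscillation on the whole neighbourhood (§3)
  have hosc : ∀ z ∈ Nbhd r γ, ∀ z' ∈ Nbhd r γ, ‖Φ z - Φ z'‖ ≤ oscConst c θ B * θ ^ (k - (i : ℕ)) := by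
    intro z hz z' hz'
    refine norm_sub_le_of_agree_young_C' hS hc hθ0 hθ1 (Nat.lt_succ_iff.mp i.isLt) (hbnd z hz) (hbnd z' hz')
      (update_mem_cbox hpC i hz) (update_mem_cbox hpC i hz') fun j hj => ?_
    have hji : j ≠ i := fun h => by subst h; exact lt_irrefl _ hj
    simp only [Function.update_of_ne hji]
  -- Cauchy's estimate at every real coupling `x ∈ ]0,γ]`
  have hderiv : ∀ x ∈ Ioc (0 : ℝ) γ,
      DifferentiableAt ℂ Φ (x : ℂ) ∧ ‖deriv Φ (x : ℂ)‖ ≤ oscConst c θ B * θ ^ (k - (i : ℕ)) / r := by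
    intro x hx
    have hball : closedBall (x : ℂ) r ⊆ U := fun z hz => hUsub (mem_nbhd_of_mem_closedBall hx hz)
    have hdc : DiffContOnCl ℂ Φ (ball (x : ℂ) r) := hdiff.diffContOnCl_ball hball
    refine ⟨hdc.differentiableAt isOpen_ball (mem_ball_self hr), ?_⟩
    have key := Complex.norm_deriv_le_of_forall_mem_sphere_norm_le hr (hdc.sub_const (Φ (x : ℂ))) fun z hz =>
      hosc z (mem_nbhd_of_mem_closedBall hx (sphere_subset_closedBall hz)) (x : ℂ) (ofReal_mem_nbhd hr.le hx)
    rwa [deriv_sub_const] at key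
  -- mean value inequality along the real coupling interval
  have hmvt := (convex_Ioc (0 : ℝ) γ).norm_image_sub_le_of_norm_hasDerivWithin_le
    (f := fun x : ℝ => Φ (x : ℂ)) (f' := fun x : ℝ => deriv Φ (x : ℂ))
    (fun x hx => ((hderiv x hx).1.hasDerivAt.comp_ofReal).hasDerivWithinAt)
    (fun x hx => (hderiv x hx).2) ((mem_box.mp hp) i) ht
  -- read the two real values off the extension
  have h1 : Φ (t : ℂ) = (β k (Function.update p i t) : ℂ) := by
    rw [← hE k (Function.update p i t)]
    show βc k _ = βc k _
    congr 1; funext j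
    exact (Function.apply_update (fun _ (x : ℝ) => (x : ℂ)) p i t j).symm
  have h2 : Φ (p i : ℂ) = (β k p : ℂ) := by
    rw [← hE k p]
    show βc k _ = βc k _
    rw [Function.update_eq_self]
  rw [h1, h2, ← Complex.ofReal_sub, Complex.norm_real, Real.norm_eq_abs, Real.norm_eq_abs] at hmvt
  calc |β k (Function.update p i t) - β k p| ≤ oscConst c θ B * θ ^ (k - (i : ℕ)) / r * |t - p i| := hmvt
    _ = analyticConst c θ B r * θ ^ (k - (i : ℕ)) * |t - p i| := by simp only [analyticConst]; ring

/-- **HEADLINE — FADING MEMORY FROM COMPLEX NE4 + ANALYTICITY, AT NE4's OWN RATE.**  Under `ExtendsC β βc`, `ScaleShiftRateC c θ γ r βc`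
(`c ≥ 0`, `0 < θ < 1`), `CoordAnalyticC B γ r βc`, `r > 0`: the moduli `Λ₁ k i := (E₀∕r)·θ^{k−i}` satisfy
`HistLipschitz Λ₁ γ β ∧ FadingMemory (E₀∕r) θ Λ₁` — node U2's two history companions of NE4, DERIVED, with the decay rate EQUAL to NE4's
(contrast `histLipschitz_fadingMemory_of_smooth`: rate `√θ` under C^{1,1}). [folklore] -/
theorem histLipschitz_fadingMemory_of_analytic {β : HBeta} {βc : HBetaC} {c θ γ r B : ℝ} (hE : ExtendsC β βc)
    (hS : ScaleShiftRateC c θ γ r βc) (hc : 0 ≤ c) (hθ0 : 0 < θ) (hθ1 : θ < 1) (hA : CoordAnalyticC B γ r βc)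
    (hr : 0 < r) :
    HistLipschitz (fun k i => analyticConst c θ B r * θ ^ (k - i)) γ β ∧
      FadingMemory (analyticConst c θ B r) θ (fun k i => analyticConst c θ B r * θ ^ (k - i)) := by
  refine ⟨histLipschitz_of_coordModuli fun k p hp i t ht => ?_, fun k i _ => ⟨?_, le_rfl⟩⟩
  · exact abs_sub_update_le_of_analytic hE hS hc hθ0 hθ1 hA hr hp i ht
  · exact mul_nonneg (analyticConst_nonneg hc hθ0 hθ1 hr) (pow_nonneg hθ0.le _)

/-! ## §5 Node U2 from {complex NE4, analyticity}: β-generic, and the faces on the data -/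

/-- **NODE U2 FROM COMPLEX NE4 + ANALYTICITY (β-generic), AT RATE `θ`.**  Complex NE4 `ScaleShiftRateC c θ γᵤ r βc` and `CoordAnalyticC B γᵤ r βc`
for an extension `βc` of `β` (`ExtendsC`), on the neighbourhood of the box `]0,γᵤ]`; two IR-pinned runs of (0.20) in `]0,γ]`, `γ ≤ γᵤ` (A: `K` steps,
B: `K+1` steps, `g^A_K = g^B_{K+1}`), the AF weight bound `Σ_{i≤K}(g^A_i)²g^B_{i+1} ≤ U` and the window `(E₀∕r)·U ≤ (1−θ)∕2` give the GEOMETRIC,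
K-UNIFORM matching `|1∕(g^A_j)² − 1∕(g^B_{j+1})²| ≤ (2c∕(1−θ))·θ^j`, `j ≤ K`, at NE4's rate `θ` — `T4CouplingMatching.disc_le_of_fadingMemory` with the
DERIVED moduli of `histLipschitz_fadingMemory_of_analytic` and the RECOVERED real NE4.  (`γ = γᵤ` is allowed: ONE radius when `r` does not shrink with
the box.)  Every β-side hypothesis UNPRINTED except the TYPE of the analyticity clause for the last coupling. [cite: Balaban1987RG1, (0.20) p.256 and §1 p.264] -/
theorem disc_le_of_analytic {β : HBeta} {βc : HBetaC} {c θ γ γu r B U : ℝ} {K : ℕ} {gA gB : ℕ → ℝ} (hE : ExtendsC β βc)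
    (hS : ScaleShiftRateC c θ γu r βc) (hc : 0 ≤ c) (hθ0 : 0 < θ) (hθ1 : θ < 1) (hA : CoordAnalyticC B γu r βc)
    (hr : 0 < r) (hγle : γ ≤ γu) (hAr : RGEqH K β gA) (hBr : RGEqH (K + 1) β gB)
    (hAbox : ∀ i, i ≤ K → 0 < gA i ∧ gA i ≤ γ) (hBbox : ∀ i, i ≤ K + 1 → 0 < gB i ∧ gB i ≤ γ) (hpin : gA K = gB (K + 1))
    (hU : ∑ i ∈ Finset.range (K + 1), (gA i) ^ 2 * gB (i + 1) ≤ U) (hsmall : analyticConst c θ B r * U ≤ (1 - θ) / 2) :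
    ∀ j, j ≤ K → disc gA gB j ≤ 2 * c / (1 - θ) * θ ^ j := by
  obtain ⟨hL, hF⟩ := histLipschitz_fadingMemory_of_analytic hE hS hc hθ0 hθ1 hA hr
  have hSr : ScaleShiftRate c θ γu β := scaleShiftRate_of_extendsC hE hS hr.le
  exact disc_le_of_fadingMemory hθ0 hθ1 hc (analyticConst_nonneg hc hθ0 hθ1 hr) hAr hBr hAbox hBbox hpin
    (fun k w hw => hSr k w (box_mono hγle (k + 1) hw))
    (fun k p q hp hq => hL k p q (box_mono hγle k hp) (box_mono hγle k hq)) hF hU hsmall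

variable {F : T4Family} {G : Type u} [GaugeGroup G] [MeasurableSpace G] [HaarData G]

/-- **ON THE DATA: NODE U2's INPUT TRIPLE FROM COMPLEX NE4 + ANALYTICITY, AT RATE `θ`.**  An extension `βc` of `D.βfun` with
`ScaleShiftRateC c θ γᵤ r βc` and `CoordAnalyticC B γᵤ r βc` (`r > 0`) gives `U2Inputs D c (E₀∕r) θ γᵤ Λ₁` (`Spine/NE4/Targets`), `Λ₁ k i = (E₀∕r)·θ^{k−i}`
— NE4 for the data recovered, both history companions derived, ONE rate throughout. [folklore] -/
theorem u2Inputs_of_analytic (D : FiniteEpsData F G) {βc : HBetaC} {c θ γu r B : ℝ} (hE : ExtendsC D.βfun βc)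
    (hS : ScaleShiftRateC c θ γu r βc) (hc : 0 ≤ c) (hθ0 : 0 < θ) (hθ1 : θ < 1) (hA : CoordAnalyticC B γu r βc)
    (hr : 0 < r) :
    U2Inputs D c (analyticConst c θ B r) θ γu (fun k i => analyticConst c θ B r * θ ^ (k - i)) :=
  ⟨scaleShiftRate_of_extendsC hE hS hr.le, histLipschitz_fadingMemory_of_analytic hE hS hc hθ0 hθ1 hA hr⟩

/-- **ON THE DATA: NODE U2's OUTPUT FROM COMPLEX NE4 + ANALYTICITY, AT RATE `θ`.**  With the extension's two shapes on `]0,γᵤ]`'s neighbourhood,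
a run box `]0,γ]`, `γ ≤ γᵤ`, the AF binders `EventualLowerH b γ k₀` (`b > 0`) and `BetaUpperH β′ γ` (`γ²β′ < 1`), a sequence `g₀` TUNED to `g`
within `]0,γ]`, and the window `(E₀∕r)·((k₀+1)γ³ + 2γ∕b) ≤ (1−θ)∕2`: `U2Output D g₀ (2c∕(1−θ)) θ` — node U6's typed source at NE4's own rate, from
{complex NE4, analyticity} instead of {NE4, moduli, their decay} (g0) or {NE4, C^{1,1}, bound} at rate `√θ` (g3). [folklore] -/
theorem u2Output_of_analytic (D : FiniteEpsData F G) {βc : HBetaC} {c θ γ γu r B b β' g : ℝ} {k₀ : ℕ} {g₀ : ℕ → ℝ}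
    (hE : ExtendsC D.βfun βc) (hS : ScaleShiftRateC c θ γu r βc) (hc : 0 ≤ c) (hθ0 : 0 < θ) (hθ1 : θ < 1)
    (hA : CoordAnalyticC B γu r βc) (hr : 0 < r) (hγ : 0 < γ) (hγle : γ ≤ γu) (hb : 0 < b)
    (hlo : EventualLowerH b γ k₀ D.βfun) (hhi : BetaUpperH β' γ D.βfun) (hγβ : γ ^ 2 * β' < 1) (ht : D.Tuned γ g g₀)
    (hsmall : analyticConst c θ B r * (((k₀ : ℝ) + 1) * γ ^ 3 + 2 * γ / b) ≤ (1 - θ) / 2) :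
    U2Output D g₀ (2 * c / (1 - θ)) θ :=
  u2Output_of_u2Inputs D ((u2Inputs_of_analytic D hE hS hc hθ0 hθ1 hA hr).mono hγle) hγ hb hθ0 hθ1 hc
    (analyticConst_nonneg hc hθ0 hθ1 hr) hlo hhi hγβ ht hsmall

/-- **ONE RADIUS, NO WINDOW BINDER** (the `FiniteEpsData.UnderHypotheses` face, cf. `u2Output_under_of_smooth`): with the extension's two shapes and
the AF binders on ONE box `]0,γᵤ]` (`EventualLowerH b γᵤ k₀`, `BetaUpperH β′ γᵤ`, `γᵤ²β′ < 1`), node U2's output `U2Output D g₀ (2c∕(1−θ)) θ` holds for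
EVERY `γ ≤ γ₀ := min(γᵤ, 1, ((1−θ)∕2)∕((E₀∕r + 1)((k₀+1)+2∕b)))`, every `g` and every sequence tuned to `g` within `]0,γ]` — the run box is chosen,
nothing is assumed small (`window_of_small_box`). [folklore] -/
theorem u2Output_under_of_analytic (D : FiniteEpsData F G) {Hβ : Prop} {βc : HBetaC} {c θ γu r B b β' : ℝ} {k₀ : ℕ}
    (hE : ExtendsC D.βfun βc) (hS : ScaleShiftRateC c θ γu r βc) (hc : 0 ≤ c) (hθ0 : 0 < θ) (hθ1 : θ < 1)
    (hA : CoordAnalyticC B γu r βc) (hr : 0 < r) (hγu : 0 < γu) (hb : 0 < b) (hlo : EventualLowerH b γu k₀ D.βfun)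
    (hhi : BetaUpperH β' γu D.βfun) (hγβ : γu ^ 2 * β' < 1) :
    D.UnderHypotheses Hβ fun g₀ => U2Output D g₀ (2 * c / (1 - θ)) θ := by
  intro _ _
  set C₁ : ℝ := analyticConst c θ B r with hC₁
  have hC : 0 ≤ C₁ := analyticConst_nonneg hc hθ0 hθ1 hr
  have hW : 0 < (1 - θ) / 2 := by linarith
  set γ₀ : ℝ := min γu (min 1 ((1 - θ) / 2 / ((C₁ + 1) * (((k₀ : ℝ) + 1) + 2 / b)))) with hγ₀
  have hγ₀pos : 0 < γ₀ := lt_min hγu (lt_min one_pos (by positivity))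
  refine ⟨γ₀, hγ₀pos, fun γ hγ hγle => ⟨1, one_pos, fun g _ _ g₀ ht => ?_⟩⟩
  have hγu' : γ ≤ γu := hγle.trans (min_le_left _ _)
  have hγ1 : γ ≤ 1 := hγle.trans ((min_le_right _ _).trans (min_le_left _ _))
  have hγW : γ ≤ (1 - θ) / 2 / ((C₁ + 1) * (((k₀ : ℝ) + 1) + 2 / b)) :=
    hγle.trans ((min_le_right _ _).trans (min_le_right _ _))
  have hsmall := window_of_small_box (k₀ := k₀) hC hb hW hγ.le hγ1 hγW
  exact u2Output_of_analytic D hE hS hc hθ0 hθ1 hA hr hγ hγu' hb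
    (fun k v hk hv => hlo k v hk (box_mono hγu' k hv)) (fun k v hv => hhi k v (box_mono hγu' k hv))
    (sq_mul_lt_one_mono hγ hγu' hγβ) ht hsmall

end Summit.QuantumFields.BalabanUV.T4Continuum.Spine.NE4

end
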